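import Summits.BirchSwinnertonDyer.Rank1Residual.WAll.AltClosers
import HarnessLib

/-!
# Rung W-ALL (D-0120): ALT-CLOSERS BY NAME for the cells of row 1 (`NonCMAtTwo`, non-CM `p = 2`) cut
# out by the lane-3 route sketch `ThetaPartnerAtTwo` (seat bsd-wall-p2) — the theta habitat and its
# residual `OffThetaHabitatAtTwo` (cell `bsd-wall`, lane 2, seat ty-2)

HONEST FRAMING (cell `bsd-wall`, run/shared/lean/pub/bsd-wall/; WALL-BRIEF-v1 §2; companion of
`WAll/AltClosers.lean` (§X5: `exclX5_of_nonCMAtTwo`, `nonCMAtTwo_of_reductionTypesAtTwo`) and of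
`WAll/AltClosersResidualCells.lean` (rows 4 / 7 / 12i), same rules: NOTHING ASSERTED, no `def`, no
`@[conjecture]`, no named fact, NO ROUTE FILE IMPORTED). Row 1 of the closed list is the REUSED rung-K4
leaf `Summit.BirchSwinnertonDyer.BirchSwinnertonDyer.Rank1Residual.NonCMAtTwo` (non-CM `E`,
`ord_{s=1} L(E,s) ≤ 1` ⇒ `BSD(E,2)`). The p2 route sketch (HOME/bsd-wall-p2/Sketch.lean sha16
3a78f7252e965241) attacks it on the THETA HABITAT — `ord_{s=1} L(E,s) = 0`, good supersingular at `2`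
with `a₂ = 0`, and a CM curve `A`, good supersingular at `2` with `a₂(A) = 0`, congruent to `E` mod `2`
away from `2·N_E·N_A` (signed Greenberg–Vatsal transport at `2` from the CM partner) — and declares
the complement as the residual item `OffThetaHabitatAtTwo`. This file re-types both cells VERBATIM and
proves, by case splits only:

| cell | this file | closes from |
|---|---|---|
| residual `OffThetaHabitatAtTwo` | `offThetaHabitatAtTwo_of_nonCMAtTwo` | LEAF K4 `NonCMAtTwo` (restriction: rung-K4 territory, route `ByReductionTypeAtTwo`) |
| residual, sub-class granularity | `offThetaHabitatAtTwo_of_reductionTypesAtTwo_of_ssOffHabitat` | K4 route items 19095 `GoodOrdinaryRankZeroAtTwo` · 19096 `MultiplicativeRankZeroAtTwo` · 19098 `AdditiveRankZeroAtTwo` · 19099 `RankOneAtTwo` (verbatim, as in `nonCMAtTwo_of_reductionTypesAtTwo`) + item 19097 `SupersingularRankZeroAtTwo` restricted OFF the habitat |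
| row 1 | `nonCMAtTwo_of_thetaHabitat_of_offThetaHabitat`, `thetaHabitat_offThetaHabitat_of_nonCMAtTwo` | habitat cell (`BSD(E,2)` currency; the route's deciding purchase) + residual; exact |
| item 19097 | `supersingularRankZeroAtTwo_of_thetaHabitat_of_ssOffHabitat` | habitat cell + its off-habitat remainder inside good-supersingular rank `0` |
| §2: the same five on the LANDED spelling (route rev 0 @5686dfab; item 20310 verbatim: the partner congruence as a `Gal(ℚ̄/ℚ)`-equivariant `E[2](ℚ̄) ≃ A[2](ℚ̄)`) | `…_torsionIso…` | same inputs |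

The congruence is the tree's `Theorems.IsCongruentModP 2 W A`, written out by its body
(`a_ℓ(W) ≡ a_ℓ(A) (mod 2)` for every prime `ℓ ∤ 2 N_W N_A`) because its home module
`Theorems/KatoDescentTamePotSupersingularDefs.lean` imports a route file; the two spellings are
definitionally equal (checked: `Iff.rfl`), so the route's `closes` feeds its items in unchanged.

References: WALL-BRIEF-v1.md §2–§3; HOME/bsd-wall-p2/Sketch.lean (3a78f7252e965241); STATUS
2026-08-27T04:42:37Z / 04:58:36Z (bsd-wall-p2); `Theorems/Rank1ResidualX5TwoDefs.lean` (`NonCMAtTwo`);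
`WAll/AltClosers.lean` §X5; [cite: Miller2011LMS, §1 and Def. 1.1].
-/

noncomputable section

open scoped Classical

open WeierstrassCurve Literature.NumberTheory.EllipticCurves
  Literature.NumberTheory.EllipticCurves.Rank1Residual

set_option autoImplicit false

namespace Summit.BirchSwinnertonDyer.Rank1Residual.WAll

open Summit.BirchSwinnertonDyer.BirchSwinnertonDyer.Rank1Residual (NonCMAtTwo)

/-! ## Row 1: the theta habitat and its residual -/

/-- **The p2 route's residual `OffThetaHabitatAtTwo` (VERBATIM, congruence unfolded) ⇐ leaf K4
`NonCMAtTwo`** — the residual is row 1 RESTRICTED off the habitat, i.e. rung-K4 territory (route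
`ByReductionTypeAtTwo`), not a new claim. [folklore] -/
theorem offThetaHabitatAtTwo_of_nonCMAtTwo (h : NonCMAtTwo) :
    ∀ (W : WeierstrassCurve ℚ) [W.IsElliptic] [W.IsGloballyMinimal], ¬ W.HasCM → W.analyticRank ≤ 1 →
      ¬ (W.analyticRank = 0 ∧ GoodSS W 2 ∧ W.frobeniusTrace 2 = 0 ∧
          ∃ (A : WeierstrassCurve ℚ) (_ : A.IsElliptic) (_ : A.IsGloballyMinimal),
            A.HasCM ∧ GoodSS A 2 ∧ A.frobeniusTrace 2 = 0 ∧
              ∀ ℓ : ℕ, ℓ.Prime → ¬ (ℓ ∣ 2 * W.conductorNorm ℤ * A.conductorNorm ℤ) →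
                ((W.LFunction ℓ : ℤ) : ZMod 2) = ((A.LFunction ℓ : ℤ) : ZMod 2)) →
      BSDp W 2 :=
  fun W _ _ hcm hr _ ↦ h W hcm hr

/-- **Row 1 from the habitat cell and the residual** (the p2 route's `closes`, re-keyed: its cruxes
`SignedTransportAtTwo` + `SignedMainConjectureCMTwo` + `SignedKatoDivisibilityUpToAtTwo` +
`SignedControlAtTwo` + PUB purchase exactly `BSD(E,2)` ON the habitat —
`Theorems.bsdp_two_of_kobayashiMainConjecture_two_of_frobeniusTrace_eq_zero`, a module in the
`ByReductionTypeAtTwo` cone, cited by name only). [folklore] -/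
theorem nonCMAtTwo_of_thetaHabitat_of_offThetaHabitat
    (hHab : ∀ (W : WeierstrassCurve ℚ) [W.IsElliptic] [W.IsGloballyMinimal], ¬ W.HasCM →
      W.analyticRank = 0 → GoodSS W 2 → W.frobeniusTrace 2 = 0 →
      (∃ (A : WeierstrassCurve ℚ) (_ : A.IsElliptic) (_ : A.IsGloballyMinimal),
        A.HasCM ∧ GoodSS A 2 ∧ A.frobeniusTrace 2 = 0 ∧
          ∀ ℓ : ℕ, ℓ.Prime → ¬ (ℓ ∣ 2 * W.conductorNorm ℤ * A.conductorNorm ℤ) →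
            ((W.LFunction ℓ : ℤ) : ZMod 2) = ((A.LFunction ℓ : ℤ) : ZMod 2)) →
      BSDp W 2)
    (hOff : ∀ (W : WeierstrassCurve ℚ) [W.IsElliptic] [W.IsGloballyMinimal], ¬ W.HasCM →
      W.analyticRank ≤ 1 →
      ¬ (W.analyticRank = 0 ∧ GoodSS W 2 ∧ W.frobeniusTrace 2 = 0 ∧
          ∃ (A : WeierstrassCurve ℚ) (_ : A.IsElliptic) (_ : A.IsGloballyMinimal),
            A.HasCM ∧ GoodSS A 2 ∧ A.frobeniusTrace 2 = 0 ∧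
              ∀ ℓ : ℕ, ℓ.Prime → ¬ (ℓ ∣ 2 * W.conductorNorm ℤ * A.conductorNorm ℤ) →
                ((W.LFunction ℓ : ℤ) : ZMod 2) = ((A.LFunction ℓ : ℤ) : ZMod 2)) →
      BSDp W 2) :
    NonCMAtTwo := by
  intro W _ _ hcm hr
  by_cases hH : (W.analyticRank = 0 ∧ GoodSS W 2 ∧ W.frobeniusTrace 2 = 0 ∧
      ∃ (A : WeierstrassCurve ℚ) (_ : A.IsElliptic) (_ : A.IsGloballyMinimal),
        A.HasCM ∧ GoodSS A 2 ∧ A.frobeniusTrace 2 = 0 ∧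
          ∀ ℓ : ℕ, ℓ.Prime → ¬ (ℓ ∣ 2 * W.conductorNorm ℤ * A.conductorNorm ℤ) →
            ((W.LFunction ℓ : ℤ) : ZMod 2) = ((A.LFunction ℓ : ℤ) : ZMod 2))
  · exact hHab W hcm hH.1 hH.2.1 hH.2.2.1 hH.2.2.2
  · exact hOff W hcm hr hH

/-- **Exactness of the habitat split of row 1**: both cells follow from `NonCMAtTwo`. [folklore] -/
theorem thetaHabitat_offThetaHabitat_of_nonCMAtTwo (h : NonCMAtTwo) :
    (∀ (W : WeierstrassCurve ℚ) [W.IsElliptic] [W.IsGloballyMinimal], ¬ W.HasCM →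
      W.analyticRank = 0 → GoodSS W 2 → W.frobeniusTrace 2 = 0 →
      (∃ (A : WeierstrassCurve ℚ) (_ : A.IsElliptic) (_ : A.IsGloballyMinimal),
        A.HasCM ∧ GoodSS A 2 ∧ A.frobeniusTrace 2 = 0 ∧
          ∀ ℓ : ℕ, ℓ.Prime → ¬ (ℓ ∣ 2 * W.conductorNorm ℤ * A.conductorNorm ℤ) →
            ((W.LFunction ℓ : ℤ) : ZMod 2) = ((A.LFunction ℓ : ℤ) : ZMod 2)) →
      BSDp W 2) ∧
    (∀ (W : WeierstrassCurve ℚ) [W.IsElliptic] [W.IsGloballyMinimal], ¬ W.HasCM →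
      W.analyticRank ≤ 1 →
      ¬ (W.analyticRank = 0 ∧ GoodSS W 2 ∧ W.frobeniusTrace 2 = 0 ∧
          ∃ (A : WeierstrassCurve ℚ) (_ : A.IsElliptic) (_ : A.IsGloballyMinimal),
            A.HasCM ∧ GoodSS A 2 ∧ A.frobeniusTrace 2 = 0 ∧
              ∀ ℓ : ℕ, ℓ.Prime → ¬ (ℓ ∣ 2 * W.conductorNorm ℤ * A.conductorNorm ℤ) →
                ((W.LFunction ℓ : ℤ) : ZMod 2) = ((A.LFunction ℓ : ℤ) : ZMod 2)) →
      BSDp W 2) :=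
  ⟨fun W _ _ hcm h0 _ _ _ ↦ h W hcm (by rw [h0]; exact zero_le_one), offThetaHabitatAtTwo_of_nonCMAtTwo h⟩

/-- **The residual at SUB-CLASS granularity ⇐ the rung-K4 route items** (route `ByReductionTypeAtTwo`,
stated verbatim as in `nonCMAtTwo_of_reductionTypesAtTwo`, `AltClosers.lean`): items 19095
`GoodOrdinaryRankZeroAtTwo` · 19096 `MultiplicativeRankZeroAtTwo` · 19098 `AdditiveRankZeroAtTwo` ·
19099 `RankOneAtTwo`, and item 19097 `SupersingularRankZeroAtTwo` RESTRICTED OFF the habitat (the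
only part of the residual inside the good-supersingular rank-`0` cell: `a₂ = ±2`, or `a₂ = 0` with no
congruent CM partner). Case split = `Theorems.byReductionTypeAtTwo_assembly_proof` re-proved in place.
[folklore] -/
theorem offThetaHabitatAtTwo_of_reductionTypesAtTwo_of_ssOffHabitat
    (hOrd : ∀ (W : WeierstrassCurve ℚ) [W.IsElliptic] [W.IsGloballyMinimal],
      ¬ W.HasCM → W.analyticRank = 0 → GoodOrd W 2 → BSDp W 2)
    (hMult : ∀ (W : WeierstrassCurve ℚ) [W.IsElliptic] [W.IsGloballyMinimal],
      ¬ W.HasCM → W.analyticRank = 0 → Mult W 2 → BSDp W 2)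
    (hAdd : ∀ (W : WeierstrassCurve ℚ) [W.IsElliptic] [W.IsGloballyMinimal],
      ¬ W.HasCM → W.analyticRank = 0 → Addv W 2 → BSDp W 2)
    (hR1 : ∀ (W : WeierstrassCurve ℚ) [W.IsElliptic] [W.IsGloballyMinimal],
      ¬ W.HasCM → W.analyticRank = 1 → BSDp W 2)
    (hSSoff : ∀ (W : WeierstrassCurve ℚ) [W.IsElliptic] [W.IsGloballyMinimal],
      ¬ W.HasCM → W.analyticRank = 0 → GoodSS W 2 →
      ¬ (W.frobeniusTrace 2 = 0 ∧
          ∃ (A : WeierstrassCurve ℚ) (_ : A.IsElliptic) (_ : A.IsGloballyMinimal),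
            A.HasCM ∧ GoodSS A 2 ∧ A.frobeniusTrace 2 = 0 ∧
              ∀ ℓ : ℕ, ℓ.Prime → ¬ (ℓ ∣ 2 * W.conductorNorm ℤ * A.conductorNorm ℤ) →
                ((W.LFunction ℓ : ℤ) : ZMod 2) = ((A.LFunction ℓ : ℤ) : ZMod 2)) →
      BSDp W 2) :
    ∀ (W : WeierstrassCurve ℚ) [W.IsElliptic] [W.IsGloballyMinimal], ¬ W.HasCM → W.analyticRank ≤ 1 →
      ¬ (W.analyticRank = 0 ∧ GoodSS W 2 ∧ W.frobeniusTrace 2 = 0 ∧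
          ∃ (A : WeierstrassCurve ℚ) (_ : A.IsElliptic) (_ : A.IsGloballyMinimal),
            A.HasCM ∧ GoodSS A 2 ∧ A.frobeniusTrace 2 = 0 ∧
              ∀ ℓ : ℕ, ℓ.Prime → ¬ (ℓ ∣ 2 * W.conductorNorm ℤ * A.conductorNorm ℤ) →
                ((W.LFunction ℓ : ℤ) : ZMod 2) = ((A.LFunction ℓ : ℤ) : ZMod 2)) →
      BSDp W 2 := by
  intro W _ _ hcm hr hH
  rcases Nat.le_one_iff_eq_zero_or_eq_one.mp hr with h0 | h1
  · by_cases hg : W.HasGoodReductionAtPrime 2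
    · by_cases ha : (2 : ℤ) ∣ W.frobeniusTrace 2
      · have hss : GoodSS W 2 := ⟨hg, by exact_mod_cast ha⟩
        exact hSSoff W hcm h0 hss (fun hrest ↦ hH ⟨h0, hss, hrest⟩)
      · exact hOrd W hcm h0 ⟨hg, by exact_mod_cast ha⟩
    · by_cases hm : W.HasMultiplicativeReductionAtPrime 2
      · exact hMult W hcm h0 hm
      · exact hAdd W hcm h0 ⟨hg, hm⟩
  · exact hR1 W hcm h1

/-- **Item 19097 `SupersingularRankZeroAtTwo` (K4, verbatim shape) from the habitat cell and its
off-habitat remainder** — so the p2 route's deciding purchase plus the good-supersingular part of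
its residual is EXACTLY rung K4's supersingular item. [folklore] -/
theorem supersingularRankZeroAtTwo_of_thetaHabitat_of_ssOffHabitat
    (hHab : ∀ (W : WeierstrassCurve ℚ) [W.IsElliptic] [W.IsGloballyMinimal], ¬ W.HasCM →
      W.analyticRank = 0 → GoodSS W 2 → W.frobeniusTrace 2 = 0 →
      (∃ (A : WeierstrassCurve ℚ) (_ : A.IsElliptic) (_ : A.IsGloballyMinimal),
        A.HasCM ∧ GoodSS A 2 ∧ A.frobeniusTrace 2 = 0 ∧
          ∀ ℓ : ℕ, ℓ.Prime → ¬ (ℓ ∣ 2 * W.conductorNorm ℤ * A.conductorNorm ℤ) →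
            ((W.LFunction ℓ : ℤ) : ZMod 2) = ((A.LFunction ℓ : ℤ) : ZMod 2)) →
      BSDp W 2)
    (hSSoff : ∀ (W : WeierstrassCurve ℚ) [W.IsElliptic] [W.IsGloballyMinimal],
      ¬ W.HasCM → W.analyticRank = 0 → GoodSS W 2 →
      ¬ (W.frobeniusTrace 2 = 0 ∧
          ∃ (A : WeierstrassCurve ℚ) (_ : A.IsElliptic) (_ : A.IsGloballyMinimal),
            A.HasCM ∧ GoodSS A 2 ∧ A.frobeniusTrace 2 = 0 ∧
              ∀ ℓ : ℕ, ℓ.Prime → ¬ (ℓ ∣ 2 * W.conductorNorm ℤ * A.conductorNorm ℤ) →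
                ((W.LFunction ℓ : ℤ) : ZMod 2) = ((A.LFunction ℓ : ℤ) : ZMod 2)) →
      BSDp W 2) :
    ∀ (W : WeierstrassCurve ℚ) [W.IsElliptic] [W.IsGloballyMinimal],
      ¬ W.HasCM → W.analyticRank = 0 → GoodSS W 2 → BSDp W 2 := by
  intro W _ _ hcm h0 hss
  by_cases hrest : (W.frobeniusTrace 2 = 0 ∧
      ∃ (A : WeierstrassCurve ℚ) (_ : A.IsElliptic) (_ : A.IsGloballyMinimal),
        A.HasCM ∧ GoodSS A 2 ∧ A.frobeniusTrace 2 = 0 ∧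
          ∀ ℓ : ℕ, ℓ.Prime → ¬ (ℓ ∣ 2 * W.conductorNorm ℤ * A.conductorNorm ℤ) →
            ((W.LFunction ℓ : ℤ) : ZMod 2) = ((A.LFunction ℓ : ℤ) : ZMod 2))
  · exact hHab W hcm h0 hss hrest.1 hrest.2
  · exact hSSoff W hcm h0 hss hrest

/-! ## §2 The LANDED shape of the p2 route (rev 0 @5686dfab, 2026-08-27T05:40Z): the CM partner
### congruence as a Galois-equivariant isomorphism of geometric `2`-torsion (item 20310 verbatim)

Route `route-BirchSwinnertonDyer-ThetaPartnerAtTwo` as OPENED states the theta habitat with the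
mod-`2` congruence to the CM partner `A` spelled as an explicit `Gal(ℚ̄/ℚ)`-equivariant isomorphism
`E[2](ℚ̄) ≃ A[2](ℚ̄)` (`∃ e : geomTorsion W 2 ≃+ geomTorsion A 2, ∀ σ P, e (σ • P) = σ • e P`) instead
of the sketch's coefficient congruence `a_ℓ(E) ≡ a_ℓ(A) (mod 2)`; its residual item
stmt-BirchSwinnertonDyer-20310 `OffThetaHabitatAtTwo` is the complement of THAT habitat. The five
theorems of §1 are repeated below on the landed spelling (suffix `_torsionIso`), VERBATIM, so that the
route's `closes` feeds its items in unchanged; the proofs are the same case splits (nothing about the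
habitat predicate is used except that it is a predicate). -/

/-- **Item 20310 `OffThetaHabitatAtTwo` (landed shape, verbatim) ⇐ LEAF K4 `NonCMAtTwo`** — the
residual is row 1 RESTRICTED off the (torsion-isomorphism) habitat: rung-K4 territory. [folklore] -/
theorem offThetaHabitatAtTwo_torsionIso_of_nonCMAtTwo (h : NonCMAtTwo) :
    ∀ (W : WeierstrassCurve ℚ) [W.IsElliptic] [W.IsGloballyMinimal], ¬ W.HasCM →
      W.analyticRank ≤ 1 →
      ¬ (W.analyticRank = 0 ∧ GoodSS W 2 ∧ W.frobeniusTrace 2 = 0 ∧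
          ∃ (A : WeierstrassCurve ℚ) (_ : A.IsElliptic) (_ : A.IsGloballyMinimal),
            A.HasCM ∧ GoodSS A 2 ∧ A.frobeniusTrace 2 = 0 ∧
              ∃ e : WeierstrassCurve.geomTorsion W (2 : ℤ) ≃+ WeierstrassCurve.geomTorsion A (2 : ℤ),
                ∀ (σ : Field.absoluteGaloisGroup ℚ) (P : WeierstrassCurve.geomTorsion W (2 : ℤ)),
                  e (σ • P) = σ • e P) →
      BSDp W 2 :=
  fun W _ _ hcm hr _ ↦ h W hcm hr

/-- **Row 1 from the (torsion-isomorphism) habitat cell and the landed residual 20310.** [folklore] -/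
theorem nonCMAtTwo_of_thetaHabitat_of_offThetaHabitat_torsionIso
    (hHab : ∀ (W : WeierstrassCurve ℚ) [W.IsElliptic] [W.IsGloballyMinimal], ¬ W.HasCM →
      W.analyticRank = 0 → GoodSS W 2 → W.frobeniusTrace 2 = 0 →
      (∃ (A : WeierstrassCurve ℚ) (_ : A.IsElliptic) (_ : A.IsGloballyMinimal),
            A.HasCM ∧ GoodSS A 2 ∧ A.frobeniusTrace 2 = 0 ∧
              ∃ e : WeierstrassCurve.geomTorsion W (2 : ℤ) ≃+ WeierstrassCurve.geomTorsion A (2 : ℤ),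
                ∀ (σ : Field.absoluteGaloisGroup ℚ) (P : WeierstrassCurve.geomTorsion W (2 : ℤ)),
                  e (σ • P) = σ • e P) →
      BSDp W 2)
    (hOff : ∀ (W : WeierstrassCurve ℚ) [W.IsElliptic] [W.IsGloballyMinimal], ¬ W.HasCM →
      W.analyticRank ≤ 1 →
      ¬ (W.analyticRank = 0 ∧ GoodSS W 2 ∧ W.frobeniusTrace 2 = 0 ∧
          ∃ (A : WeierstrassCurve ℚ) (_ : A.IsElliptic) (_ : A.IsGloballyMinimal),
            A.HasCM ∧ GoodSS A 2 ∧ A.frobeniusTrace 2 = 0 ∧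
              ∃ e : WeierstrassCurve.geomTorsion W (2 : ℤ) ≃+ WeierstrassCurve.geomTorsion A (2 : ℤ),
                ∀ (σ : Field.absoluteGaloisGroup ℚ) (P : WeierstrassCurve.geomTorsion W (2 : ℤ)),
                  e (σ • P) = σ • e P) →
      BSDp W 2) :
    NonCMAtTwo := by
  intro W _ _ hcm hr
  by_cases hH : (W.analyticRank = 0 ∧ GoodSS W 2 ∧ W.frobeniusTrace 2 = 0 ∧
      ∃ (A : WeierstrassCurve ℚ) (_ : A.IsElliptic) (_ : A.IsGloballyMinimal),
            A.HasCM ∧ GoodSS A 2 ∧ A.frobeniusTrace 2 = 0 ∧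
              ∃ e : WeierstrassCurve.geomTorsion W (2 : ℤ) ≃+ WeierstrassCurve.geomTorsion A (2 : ℤ),
                ∀ (σ : Field.absoluteGaloisGroup ℚ) (P : WeierstrassCurve.geomTorsion W (2 : ℤ)),
                  e (σ • P) = σ • e P)
  · exact hHab W hcm hH.1 hH.2.1 hH.2.2.1 hH.2.2.2
  · exact hOff W hcm hr hH

/-- **Exactness of the (torsion-isomorphism) habitat split of row 1**: both cells follow from
`NonCMAtTwo`. [folklore] -/
theorem thetaHabitat_offThetaHabitat_torsionIso_of_nonCMAtTwo (h : NonCMAtTwo) :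
    (∀ (W : WeierstrassCurve ℚ) [W.IsElliptic] [W.IsGloballyMinimal], ¬ W.HasCM →
      W.analyticRank = 0 → GoodSS W 2 → W.frobeniusTrace 2 = 0 →
      (∃ (A : WeierstrassCurve ℚ) (_ : A.IsElliptic) (_ : A.IsGloballyMinimal),
            A.HasCM ∧ GoodSS A 2 ∧ A.frobeniusTrace 2 = 0 ∧
              ∃ e : WeierstrassCurve.geomTorsion W (2 : ℤ) ≃+ WeierstrassCurve.geomTorsion A (2 : ℤ),
                ∀ (σ : Field.absoluteGaloisGroup ℚ) (P : WeierstrassCurve.geomTorsion W (2 : ℤ)),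
                  e (σ • P) = σ • e P) →
      BSDp W 2) ∧
    (∀ (W : WeierstrassCurve ℚ) [W.IsElliptic] [W.IsGloballyMinimal], ¬ W.HasCM →
      W.analyticRank ≤ 1 →
      ¬ (W.analyticRank = 0 ∧ GoodSS W 2 ∧ W.frobeniusTrace 2 = 0 ∧
          ∃ (A : WeierstrassCurve ℚ) (_ : A.IsElliptic) (_ : A.IsGloballyMinimal),
            A.HasCM ∧ GoodSS A 2 ∧ A.frobeniusTrace 2 = 0 ∧
              ∃ e : WeierstrassCurve.geomTorsion W (2 : ℤ) ≃+ WeierstrassCurve.geomTorsion A (2 : ℤ),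
                ∀ (σ : Field.absoluteGaloisGroup ℚ) (P : WeierstrassCurve.geomTorsion W (2 : ℤ)),
                  e (σ • P) = σ • e P) →
      BSDp W 2) :=
  ⟨fun W _ _ hcm h0 _ _ _ ↦ h W hcm (by rw [h0]; exact zero_le_one),
    offThetaHabitatAtTwo_torsionIso_of_nonCMAtTwo h⟩

/-- **The landed residual 20310 at SUB-CLASS granularity ⇐ the rung-K4 route items** 19095
`GoodOrdinaryRankZeroAtTwo` · 19096 `MultiplicativeRankZeroAtTwo` · 19098 `AdditiveRankZeroAtTwo` ·
19099 `RankOneAtTwo` (verbatim) + item 19097 `SupersingularRankZeroAtTwo` restricted OFF the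
(torsion-isomorphism) habitat. [folklore] -/
theorem offThetaHabitatAtTwo_torsionIso_of_reductionTypesAtTwo_of_ssOffHabitat
    (hOrd : ∀ (W : WeierstrassCurve ℚ) [W.IsElliptic] [W.IsGloballyMinimal],
      ¬ W.HasCM → W.analyticRank = 0 → GoodOrd W 2 → BSDp W 2)
    (hMult : ∀ (W : WeierstrassCurve ℚ) [W.IsElliptic] [W.IsGloballyMinimal],
      ¬ W.HasCM → W.analyticRank = 0 → Mult W 2 → BSDp W 2)
    (hAdd : ∀ (W : WeierstrassCurve ℚ) [W.IsElliptic] [W.IsGloballyMinimal],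
      ¬ W.HasCM → W.analyticRank = 0 → Addv W 2 → BSDp W 2)
    (hR1 : ∀ (W : WeierstrassCurve ℚ) [W.IsElliptic] [W.IsGloballyMinimal],
      ¬ W.HasCM → W.analyticRank = 1 → BSDp W 2)
    (hSSoff : ∀ (W : WeierstrassCurve ℚ) [W.IsElliptic] [W.IsGloballyMinimal],
      ¬ W.HasCM → W.analyticRank = 0 → GoodSS W 2 →
      ¬ (W.frobeniusTrace 2 = 0 ∧
          ∃ (A : WeierstrassCurve ℚ) (_ : A.IsElliptic) (_ : A.IsGloballyMinimal),
            A.HasCM ∧ GoodSS A 2 ∧ A.frobeniusTrace 2 = 0 ∧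
              ∃ e : WeierstrassCurve.geomTorsion W (2 : ℤ) ≃+ WeierstrassCurve.geomTorsion A (2 : ℤ),
                ∀ (σ : Field.absoluteGaloisGroup ℚ) (P : WeierstrassCurve.geomTorsion W (2 : ℤ)),
                  e (σ • P) = σ • e P) →
      BSDp W 2) :
    ∀ (W : WeierstrassCurve ℚ) [W.IsElliptic] [W.IsGloballyMinimal], ¬ W.HasCM →
      W.analyticRank ≤ 1 →
      ¬ (W.analyticRank = 0 ∧ GoodSS W 2 ∧ W.frobeniusTrace 2 = 0 ∧
          ∃ (A : WeierstrassCurve ℚ) (_ : A.IsElliptic) (_ : A.IsGloballyMinimal),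
            A.HasCM ∧ GoodSS A 2 ∧ A.frobeniusTrace 2 = 0 ∧
              ∃ e : WeierstrassCurve.geomTorsion W (2 : ℤ) ≃+ WeierstrassCurve.geomTorsion A (2 : ℤ),
                ∀ (σ : Field.absoluteGaloisGroup ℚ) (P : WeierstrassCurve.geomTorsion W (2 : ℤ)),
                  e (σ • P) = σ • e P) →
      BSDp W 2 := by
  intro W _ _ hcm hr hH
  rcases Nat.le_one_iff_eq_zero_or_eq_one.mp hr with h0 | h1
  · by_cases hg : W.HasGoodReductionAtPrime 2
    · by_cases ha : (2 : ℤ) ∣ W.frobeniusTrace 2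
      · have hss : GoodSS W 2 := ⟨hg, by exact_mod_cast ha⟩
        exact hSSoff W hcm h0 hss (fun hrest ↦ hH ⟨h0, hss, hrest⟩)
      · exact hOrd W hcm h0 ⟨hg, by exact_mod_cast ha⟩
    · by_cases hm : W.HasMultiplicativeReductionAtPrime 2
      · exact hMult W hcm h0 hm
      · exact hAdd W hcm h0 ⟨hg, hm⟩
  · exact hR1 W hcm h1

/-- **Item 19097 `SupersingularRankZeroAtTwo` (K4, verbatim) from the (torsion-isomorphism)
habitat cell and its off-habitat remainder.** [folklore] -/
theorem supersingularRankZeroAtTwo_of_thetaHabitat_torsionIso_of_ssOffHabitat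
    (hHab : ∀ (W : WeierstrassCurve ℚ) [W.IsElliptic] [W.IsGloballyMinimal], ¬ W.HasCM →
      W.analyticRank = 0 → GoodSS W 2 → W.frobeniusTrace 2 = 0 →
      (∃ (A : WeierstrassCurve ℚ) (_ : A.IsElliptic) (_ : A.IsGloballyMinimal),
            A.HasCM ∧ GoodSS A 2 ∧ A.frobeniusTrace 2 = 0 ∧
              ∃ e : WeierstrassCurve.geomTorsion W (2 : ℤ) ≃+ WeierstrassCurve.geomTorsion A (2 : ℤ),
                ∀ (σ : Field.absoluteGaloisGroup ℚ) (P : WeierstrassCurve.geomTorsion W (2 : ℤ)),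
                  e (σ • P) = σ • e P) →
      BSDp W 2)
    (hSSoff : ∀ (W : WeierstrassCurve ℚ) [W.IsElliptic] [W.IsGloballyMinimal],
      ¬ W.HasCM → W.analyticRank = 0 → GoodSS W 2 →
      ¬ (W.frobeniusTrace 2 = 0 ∧
          ∃ (A : WeierstrassCurve ℚ) (_ : A.IsElliptic) (_ : A.IsGloballyMinimal),
            A.HasCM ∧ GoodSS A 2 ∧ A.frobeniusTrace 2 = 0 ∧
              ∃ e : WeierstrassCurve.geomTorsion W (2 : ℤ) ≃+ WeierstrassCurve.geomTorsion A (2 : ℤ),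
                ∀ (σ : Field.absoluteGaloisGroup ℚ) (P : WeierstrassCurve.geomTorsion W (2 : ℤ)),
                  e (σ • P) = σ • e P) →
      BSDp W 2) :
    ∀ (W : WeierstrassCurve ℚ) [W.IsElliptic] [W.IsGloballyMinimal],
      ¬ W.HasCM → W.analyticRank = 0 → GoodSS W 2 → BSDp W 2 := by
  intro W _ _ hcm h0 hss
  by_cases hrest : (W.frobeniusTrace 2 = 0 ∧
      ∃ (A : WeierstrassCurve ℚ) (_ : A.IsElliptic) (_ : A.IsGloballyMinimal),
            A.HasCM ∧ GoodSS A 2 ∧ A.frobeniusTrace 2 = 0 ∧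
              ∃ e : WeierstrassCurve.geomTorsion W (2 : ℤ) ≃+ WeierstrassCurve.geomTorsion A (2 : ℤ),
                ∀ (σ : Field.absoluteGaloisGroup ℚ) (P : WeierstrassCurve.geomTorsion W (2 : ℤ)),
                  e (σ • P) = σ • e P)
  · exact hHab W hcm h0 hss hrest.1 hrest.2
  · exact hSSoff W hcm h0 hss hrest

end Summit.BirchSwinnertonDyer.Rank1Residual.WAll

end
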